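import Mathlib
import Summits.CriticalPhenomena.PercolationContinuityZ3.Theorems.PercNearOneGluingNoHeavyQuantTwoArcSun
import HarnessLib

/-!
# QUANT lane R8, "FAR beyond trees", layer one on hairy cycles — `SunFAR K 1` beyond the sure tip: affinity in the hair weight (bridge, part 3)

builds on p205010 (kernel theorem, internal audit signed; external expert review pending)

Support file (`--supports stmt-CriticalPhenomena-4575`), seat `prim-quant-p1` (gen 17); memo `quant/prim-quant-p1-g17/FOR-LEAD-TWOCHAIN-B.md` §4.
* `hairW_update_affine`, `sunLaw_update_affine` — the sun law is affine in each single hair weight `h a`;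
* `sunMarg_update_of_ne`, `sunMarg_eq_mul_update` — `T_b` does not see `h a` (`b ≠ a`), `T_a = h a · ρ_a` (`ρ_a` = the sure-hair marginal);
* **`sunMarg_le_sunLaw_two_le_of_cycle_le`** — the two-arc lemma for a tip `a` with ARBITRARY hair weight whose cycle vertex is already least likely
  (`ρ_a ≤ T_b` for all `b ≠ a`) and `Σ_{b≠a} T_b ≥ 1`: `sunMarg a ≤ sunLaw (2 ≤ #·)` (at `h a = 0` the law is `≥ 0`, at `h a = 1` it is
  `sunMarg_le_sunLaw_two_le_of_sure`; affine in between);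
* **`sunFAR_one_of_argmin_cycle_le`** — `SunFAR K 1`'s conclusion for every weight configuration admitting such a tip.  The configurations NOT covered
  are exactly those where the least-likely tip `a` has `h a < 1` and `ρ_a > min_{b≠a} T_b` — the "tied-random" case (memo §5), OPEN;
* `SunTiedFAR K` — that remaining case as ONE named statement, and **`sunFAR_one_of_tied : SunTiedFAR K → SunFAR K 1`** (`K ≥ 2`): the law-level FAR row
  at layer one for the sun is CLOSED MODULO the tied-random case.
No sorries; standard axioms. [this work]
-/


namespace Summit.CriticalPhenomena.PercolationContinuityZ3.Theorems

namespace Quant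

namespace TwoArc

open Finset
open Summit.CriticalPhenomena.PercolationContinuityZ3.Theorems.HairyCycle

/-! ## The law is affine in each hair weight; the least-likely tip with a random hair whose CYCLE VERTEX is already least likely -/

section affine
variable {K : ℕ}

/-- `hairW` is affine in the hair weight of one tip. [this work] -/
theorem hairW_update_affine (h : ℕ → ℝ) {a : ℕ} (ha : a < K) (Q : Finset ℕ) :
    hairW K h Q = (1 - h a) * hairW K (Function.update h a 0) Q + h a * hairW K (Function.update h a 1) Q := by
  classical
  have haK : a ∈ Finset.range K := Finset.mem_range.2 ha
  have split : ∀ f : ℕ → ℝ, hairW K f Q = (if a ∈ Q then f a else 1 - f a) *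
      ∏ k ∈ (Finset.range K).erase a, (if k ∈ Q then f k else 1 - f k) := fun f => by
    unfold hairW; rw [← Finset.mul_prod_erase _ _ haK]
  have hrest : ∀ t : ℝ, ∏ k ∈ (Finset.range K).erase a, (if k ∈ Q then Function.update h a t k else 1 - Function.update h a t k)
      = ∏ k ∈ (Finset.range K).erase a, (if k ∈ Q then h k else 1 - h k) := fun t =>
    Finset.prod_congr rfl fun k hk => by rw [Function.update_of_ne (Finset.ne_of_mem_erase hk)]
  rw [split h, split (Function.update h a 0), split (Function.update h a 1), hrest 0, hrest 1]
  simp only [Function.update_self]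
  by_cases haQ : a ∈ Q <;> simp [haQ]

/-- `sunLaw` is affine in the hair weight of one tip. [this work] -/
theorem sunLaw_update_affine (g h : ℕ → ℝ) {a : ℕ} (ha : a < K) (Φ : Finset ℕ → Prop) :
    sunLaw K g h Φ = (1 - h a) * sunLaw K g (Function.update h a 0) Φ + h a * sunLaw K g (Function.update h a 1) Φ := by
  classical
  unfold sunLaw
  rw [Finset.mul_sum, Finset.mul_sum, ← Finset.sum_add_distrib]
  refine Finset.sum_congr rfl fun Q _ => ?_
  rw [Finset.mul_sum, Finset.mul_sum, ← Finset.sum_add_distrib]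
  refine Finset.sum_congr rfl fun p _ => ?_
  rw [hairW_update_affine h ha Q]
  ring

/-- Marginals of the other tips do not see `h a`. [this work] -/
theorem sunMarg_update_of_ne (g h : ℕ → ℝ) {a b : ℕ} (hba : b ≠ a) (t : ℝ) :
    sunMarg K g (Function.update h a t) b = sunMarg K g h b := by
  simp [sunMarg, Function.update_of_ne hba]

/-- The marginal of tip `a` is `h a` times the marginal of its sure version (the coverage probability of its cycle vertex). [this work] -/
theorem sunMarg_eq_mul_update (g h : ℕ → ℝ) (a : ℕ) :
    sunMarg K g h a = h a * sunMarg K g (Function.update h a 1) a := by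
  simp [sunMarg]

variable (hK : 2 ≤ K) {g h : ℕ → ℝ} (hg : ∀ m, m ≤ K → 0 ≤ g m ∧ g m ≤ 1) (hh : ∀ k, k < K → 0 ≤ h k ∧ h k ≤ 1)
include hK hg hh

/-- **The two-arc lemma on the sun for a least-likely tip whose CYCLE VERTEX is already least likely** (`ρ_a ≤ T_b` for all other tips; the tip's own
hair weight arbitrary): `sunMarg a ≤ sunLaw (2 ≤ #·)`.  By affinity in `h a`: at `h a = 0` the law is `≥ 0`, at `h a = 1` it is the sure case. [this work] -/
theorem sunMarg_le_sunLaw_two_le_of_cycle_le {a : ℕ} (ha : a < K)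
    (hmin : ∀ b, b < K → b ≠ a → sunMarg K g (Function.update h a 1) a ≤ sunMarg K g h b)
    (hσ : 1 ≤ ∑ b ∈ (Finset.range K).erase a, sunMarg K g h b) :
    sunMarg K g h a ≤ sunLaw K g h (fun R => 2 ≤ R.card) := by
  set h₁ := Function.update h a 1 with hh₁
  set h₀ := Function.update h a 0 with hh₀
  have hb1 : ∀ k, k < K → 0 ≤ h₁ k ∧ h₁ k ≤ 1 := fun k hk => by
    by_cases hka : k = a
    · subst hka; simp [hh₁]
    · rw [hh₁, Function.update_of_ne hka]; exact hh k hk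
  have hb0 : ∀ k, k < K → 0 ≤ h₀ k ∧ h₀ k ≤ 1 := fun k hk => by
    by_cases hka : k = a
    · subst hka; simp [hh₀]
    · rw [hh₀, Function.update_of_ne hka]; exact hh k hk
  have hsure := sunMarg_le_sunLaw_two_le_of_sure hK hg hb1 ha (by simp [hh₁])
    (fun b hb => by
      by_cases hba : b = a
      · subst hba; exact le_rfl
      · rw [sunMarg_update_of_ne g h hba]; exact hmin b hb hba)
    (by rwa [Finset.sum_congr rfl fun b hb => sunMarg_update_of_ne g h (Finset.ne_of_mem_erase hb) (1:ℝ)])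
  have h0 : 0 ≤ sunLaw K g h₀ (fun R => 2 ≤ R.card) := sunLaw_nonneg hK hg hb0 _
  have ha01 := hh a ha
  rw [sunLaw_update_affine g h ha, sunMarg_eq_mul_update g h a]
  nlinarith [mul_nonneg (sub_nonneg.2 ha01.2) h0, mul_le_mul_of_nonneg_left hsure ha01.1]

/-- **`SunFAR K 1` whenever the least-likely tip stays least likely with its hair made sure** (its cycle vertex is at most as likely as every other
tip): the open complement is exactly the tied-random configuration of memo §5. [this work] -/
theorem sunFAR_one_of_argmin_cycle_le (hsum : (2 : ℝ) < ∑ k ∈ Finset.range K, sunMarg K g h k)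
    (hex : ∃ a, a < K ∧ ∀ b, b < K → b ≠ a → sunMarg K g (Function.update h a 1) a ≤ sunMarg K g h b)
    (t : ℝ) (ht : ∀ k, k < K → 1 - sunMarg K g h k ≤ t) :
    sunLaw K g h (fun R => R.card ≤ 1) ≤ t := by
  obtain ⟨a, ha, hmin⟩ := hex
  have hxa : sunMarg K g h a ≤ 1 := by
    rw [← sunLaw_mem_eq_sunMarg hK hg hh ha]; exact sunLaw_le_one hK hg hh _
  have hσ : 1 ≤ ∑ b ∈ (Finset.range K).erase a, sunMarg K g h b := by
    have := Finset.sum_erase_add (Finset.range K) (sunMarg K g h) (Finset.mem_range.2 ha)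
    linarith
  have hmain := sunMarg_le_sunLaw_two_le_of_cycle_le hK hg hh ha hmin hσ
  have htail := sunLaw_card_ge_eq hK hg hh 1
  have := ht a ha
  rw [show (fun R : Finset ℕ => 1 + 1 ≤ R.card) = (fun R => 2 ≤ R.card) from rfl] at htail
  linarith

/-! ## What is left of `SunFAR K 1`: the tied-random least-likely tip, as one named statement -/

omit hK hg hh in
/-- **The tied-random case of `SunFAR K 1`** (the ONLY configurations not covered by `sunFAR_one_of_sure_argmin` / `sunFAR_one_of_argmin_cycle_le`):
a least-likely tip `a` with a random hair (`h a < 1`) whose cycle vertex is NOT least likely (`ρ_a > T_b` for some other tip `b`) still satisfies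
`T_a ≤ P(# reached tips ≥ 2)` when `Σ_k T_k > 2`.  OPEN (p1 g17 memo `FOR-LEAD-TWOCHAIN-B.md` §5: reductions R1–R12, 0 violations numerically). [this work] -/
def SunTiedFAR (K : ℕ) : Prop :=
  ∀ g h : ℕ → ℝ, (∀ m, m ≤ K → 0 ≤ g m ∧ g m ≤ 1) → (∀ k, k < K → 0 ≤ h k ∧ h k ≤ 1) →
    (2 : ℝ) < ∑ k ∈ Finset.range K, sunMarg K g h k →
    ∀ a, a < K → (∀ b, b < K → sunMarg K g h a ≤ sunMarg K g h b) → h a < 1 →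
      (∃ b, b < K ∧ b ≠ a ∧ sunMarg K g h b < sunMarg K g (Function.update h a 1) a) →
      sunMarg K g h a ≤ sunLaw K g h (fun R => 2 ≤ R.card)

omit hg hh in
/-- **`SunFAR K 1` CLOSED MODULO THE TIED-RANDOM CASE**: the sure-argmin theorem, its affine extension and `SunTiedFAR K` together give the law-level
FAR row at layer one for the sun with `K` hairs (every `K ≥ 2`). [this work] -/
theorem sunFAR_one_of_tied (H : SunTiedFAR K) : SunFAR K 1 := by
  rw [sunFAR_iff_tail hK 1]
  intro g h hg hh hsum x hx
  rw [show (fun R : Finset ℕ => 1 + 1 ≤ R.card) = (fun R => 2 ≤ R.card) from rfl]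
  -- a least-likely tip
  have hne : (Finset.range K).Nonempty := ⟨0, Finset.mem_range.2 (by omega)⟩
  obtain ⟨a, haK, hamin⟩ := Finset.exists_min_image (Finset.range K) (sunMarg K g h) hne
  have ha : a < K := Finset.mem_range.1 haK
  have hmin : ∀ b, b < K → sunMarg K g h a ≤ sunMarg K g h b := fun b hb => hamin b (Finset.mem_range.2 hb)
  have hxa : sunMarg K g h a ≤ 1 := by
    rw [← sunLaw_mem_eq_sunMarg hK hg hh ha]; exact sunLaw_le_one hK hg hh _
  have hσ : 1 ≤ ∑ b ∈ (Finset.range K).erase a, sunMarg K g h b := by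
    have := Finset.sum_erase_add (Finset.range K) (sunMarg K g h) haK
    norm_num at hsum
    linarith
  refine (hx a ha).trans ?_
  by_cases hha : h a = 1
  · exact sunMarg_le_sunLaw_two_le_of_sure hK hg hh ha hha hmin hσ
  · have hha' : h a < 1 := lt_of_le_of_ne (hh a ha).2 hha
    by_cases hcyc : ∀ b, b < K → b ≠ a → sunMarg K g (Function.update h a 1) a ≤ sunMarg K g h b
    · exact sunMarg_le_sunLaw_two_le_of_cycle_le hK hg hh ha hcyc hσ
    · simp only [not_forall, not_le, exists_prop] at hcyc
      obtain ⟨b, hb, hba, hlt⟩ := hcyc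
      have hsum' : (2 : ℝ) < ∑ k ∈ Finset.range K, sunMarg K g h k := by norm_num at hsum; exact hsum
      exact H g h hg hh hsum' a ha hmin hha' ⟨b, hb, hba, hlt⟩

end affine

end TwoArc

end Quant

end Summit.CriticalPhenomena.PercolationContinuityZ3.Theorems
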